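import Summits.BirchSwinnertonDyer.BirchSwinnertonDyer.Theorems.AlignedTransportAtTwoMainConjectureOfRankZeroBSDAtTwoFineRoadRealKummerLinesLetterSwitch
import HarnessLib

/-!
# A rational change of variables on the `2`-division cubics: `ψ_{C • W}(u⁻²(x − r)) = u⁻⁶ψ_W(x)`, `c_{C • W}(u⁻²(y − 4r)) = u⁻⁶c_W(y)`;
# `E(ℚ)[2] = 0` and `Δ ∉ ℚ²` are preserved

Cell `bsd-f1-sign2`, WIDTH-5 attach seat `bsd-line-att-p5` (gen 15) on line `birth` of crux C2 stmt-BirchSwinnertonDyer-22298; bookkeeping for the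
capstone `…LetterSwitchMinimalModel` (passing from the integer model of the letter switch to its global minimal model). `--supports 22298 --as helper`.
HONEST FRAMING: THEOREMS ONLY — elementary identities (Silverman III.1 Table 3.1); C1/C2-NEUTRAL; BSD is NOT proved by any of this.

References: J. H. Silverman, *AEC* (2009) III.1 Table 3.1, III.2.3.
-/

set_option autoImplicit false
-- the Theorems namespace of this sub repeats the summit name by design (D-0017 nested layout)
set_option linter.dupNamespace false

noncomputable section

open scoped Classical

namespace Summit.BirchSwinnertonDyer.BirchSwinnertonDyer.Theorems.AlignedTransportAtTwoFineRoad.RealKummerLinesLetterSwitchVariableChange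

open Polynomial WeierstrassCurve Literature.NumberTheory.EllipticCurves Literature.NumberTheory.EllipticCurves.Greenberg1999
  Summit.BirchSwinnertonDyer.Rank1Residual.F1Sign2
  Summit.BirchSwinnertonDyer.BirchSwinnertonDyer.Theorems.AlignedTransportAtTwoBridge
  Summit.BirchSwinnertonDyer.Rank1Residual.X5.Instances

/-! ## §1 A change of variables on the `2`-division cubics and on the cell binders -/

section Change

variable (W : WeierstrassCurve ℚ) (C : VariableChange ℚ)

/-- `ψ_{C • W}(u⁻²(x − r)) = u⁻⁶ψ_W(x)` in any field of characteristic `0`. [cite: SilvermanAEC2009, III.1 Table 3.1] -/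
theorem psi_smul {K : Type*} [Field K] [CharZero K] (x : K) :
    4 * ((((↑C.u⁻¹ : ℚ) : K)) ^ 2 * (x - (C.r : K))) ^ 3 + ((C • W).b₂ : K) * ((((↑C.u⁻¹ : ℚ) : K)) ^ 2 * (x - (C.r : K))) ^ 2 +
        2 * ((C • W).b₄ : K) * ((((↑C.u⁻¹ : ℚ) : K)) ^ 2 * (x - (C.r : K))) + ((C • W).b₆ : K) =
      (((↑C.u⁻¹ : ℚ) : K)) ^ 6 * (4 * x ^ 3 + (W.b₂ : K) * x ^ 2 + 2 * (W.b₄ : K) * x + (W.b₆ : K)) := by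
  rw [variableChange_b₂, variableChange_b₄, variableChange_b₆]
  push_cast
  ring

/-- `c_{C • W}(u⁻²(y − 4r)) = u⁻⁶c_W(y)` (`u`-cubics). [cite: SilvermanAEC2009, III.1 Table 3.1] -/
theorem cubic_smul {K : Type*} [Field K] [CharZero K] (y : K) :
    ((((↑C.u⁻¹ : ℚ) : K)) ^ 2 * (y - 4 * (C.r : K))) ^ 3 + ((C • W).b₂ : K) * ((((↑C.u⁻¹ : ℚ) : K)) ^ 2 * (y - 4 * (C.r : K))) ^ 2 +
        8 * ((C • W).b₄ : K) * ((((↑C.u⁻¹ : ℚ) : K)) ^ 2 * (y - 4 * (C.r : K))) + 16 * ((C • W).b₆ : K) =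
      (((↑C.u⁻¹ : ℚ) : K)) ^ 6 * (y ^ 3 + (W.b₂ : K) * y ^ 2 + 8 * (W.b₄ : K) * y + 16 * (W.b₆ : K)) := by
  rw [variableChange_b₂, variableChange_b₄, variableChange_b₆]
  push_cast
  ring

/-- `E(ℚ)[2] = 0` is preserved by a rational change of variables. [cite: SilvermanAEC2009, III.2.3] -/
theorem forall_not_hasRationalTwoTorsionX_smul (ht : ∀ x : ℚ, ¬ HasRationalTwoTorsionX W x) :
    ∀ x : ℚ, ¬ HasRationalTwoTorsionX (C • W) x := by
  intro x hx
  have hψ := cubic_eq_zero_of_hasRationalTwoTorsionX hx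
  set x₀ : ℚ := (C.u : ℚ) ^ 2 * x + C.r with hx₀
  have hx : x = ((↑C.u⁻¹ : ℚ)) ^ 2 * (x₀ - C.r) := by
    rw [hx₀, Units.val_inv_eq_inv_val]; field_simp; ring
  have hψ₀ : 4 * x₀ ^ 3 + W.b₂ * x₀ ^ 2 + 2 * W.b₄ * x₀ + W.b₆ = 0 := by
    have h := psi_smul W C (K := ℚ) x₀
    simp only [Rat.cast_id] at h
    rw [← hx, hψ] at h
    have hu : ((↑C.u⁻¹ : ℚ)) ^ 6 ≠ 0 := pow_ne_zero 6 (Units.ne_zero _)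
    exact (mul_eq_zero.mp h.symm).resolve_left hu
  refine ht (4 * x₀ / 4) (hasRationalTwoTorsionX_of_isRoot W ?_)
  simp only [IsRoot.def, twoDivisionUCubic, eval_add, eval_mul, eval_pow, eval_X, eval_C]
  linear_combination 16 * hψ₀

/-- `Δ ∉ ℚ²` is preserved by a rational change of variables (`Δ′ = (u⁻⁶)²Δ`). [cite: SilvermanAEC2009, III.1 Table 3.1] -/
theorem not_isSquare_Δ_smul (hsq : ¬ IsSquare W.Δ) : ¬ IsSquare (C • W).Δ := by
  rw [variableChange_Δ, Units.val_inv_eq_inv_val]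
  rintro ⟨s, hs⟩
  refine hsq ⟨s * (C.u : ℚ) ^ 6, ?_⟩
  have hu0 : (C.u : ℚ) ≠ 0 := Units.ne_zero _
  field_simp at hs
  linear_combination hs

end Change


end Summit.BirchSwinnertonDyer.BirchSwinnertonDyer.Theorems.AlignedTransportAtTwoFineRoad.RealKummerLinesLetterSwitchVariableChange
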